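import Mathlib.Data.Nat.Choose.Vandermonde
import Summits.ValiantsHypothesis.ValiantsHypothesis.Theorems.LacunarySymmetroidMatrixDescartesCensusTropicalKLawSlopes
import Summits.ValiantsHypothesis.ValiantsHypothesis.Theorems.LacunarySymmetroidMatrixDescartesCensusTropicalKLawBridges

/-!
# Route «KPlusLogSqLaw», crux `Lifting` — the DESCARTES MECHANISM cannot reach the fat stub off the cones (unless TB fails)

HONEST FRAMING.  Helper file for the crux `Summit.ValiantsHypothesis.ValiantsHypothesis.Theses.KPlusLogSqLaw.Lifting`
(ledger item `stmt-ValiantsHypothesis-19772`; route `KPlusLogSqLaw`, object-search cell `pub-symmetroid`, seat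
val-sym-lift-p2, 2026-08-26).  It proves ONE implication between open statements of the cell and nothing else: no statement
about `TropicalB`, `Lifting`, `KPlusLogSqLaw`, `MatrixDescartes` or `VP ≠ VNP` is asserted.

THE MECHANISM.  Every lifting rung the cell owns (`Lifting_rung_two`, `stub_liftRungThree`, the Descartes zones of
`…LiftingDescartesZone`) is the DESCARTES MECHANISM: the real row is bounded by the Descartes ceiling
`Census.realRootLawAt_descartes` (`ζ(m,K) ≤ 2·C(m+K−1,m) − 1`), and the tropical hypothesis `TropRootLawAt m K n` is used
only through an explicit near-counting-tight design family, i.e. through an inequality `C(m+K−1,m) ≤ 2^(C₁K)·(n+1)`.  On the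
fat regime `log₂² m ≤ K` this inequality, uniformly in `(m, K)`, is the hypothesis `DescartesFat` below (spelled inline).

THE THEOREM `not_tropKPlusLogSqLaw_of_descartesFat`:  `DescartesFat → ¬ TropKPlusLogSqLaw` (`TropKPlusLogSqLaw` is
δ-equal to the route decl `TropicalB`).  So the Descartes mechanism can prove `stub_liftFat` beyond the linear cones only in a
world where the route's other crux is FALSE; in-window lifting on the fat side needs a real zero bound below Descartes
(compare `…LiftingFatLocation`: modulo `stub_tropFat`, `stub_liftFat` is Conjecture B on fat formats).  The thin twin
(`K ≤ log₂² m`, witness `K = (2C+2)·log₂ m`) is val-sym-lift-p1's.  Witness family here: `K = 4^i`, `m = 2^(2^i)` (so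
`log₂² m = K` exactly), `m / K = 2^(2^i − 2i)`, and the elementary bound `C(m+K−1, K−1) ≥ (m/K + 1)^(K−1)`
(`succ_pow_le_choose_mul`, by Vandermonde).
-/

set_option linter.dupNamespace false
set_option autoImplicit false

namespace Summit.ValiantsHypothesis.ValiantsHypothesis.Theorems.KPlusLogSqLaw

open Summit.ValiantsHypothesis.ValiantsHypothesis.Theorems.LacunarySymmetroidMatrixDescartes.TropicalCensus
  (TropRootLawAt TropKPlusLogSqLaw)

/-- `(q+1)^k ≤ C(k(q+1), k)` — a factorial-free lower bound for binomial coefficients (induction on `k` with Vandermonde's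
identity: `C(k(q+1) + (q+1), k+1) ≥ C(k(q+1), k)·C(q+1, 1)`). [folklore] -/
theorem succ_pow_le_choose_mul (q k : ℕ) : (q + 1) ^ k ≤ Nat.choose (k * (q + 1)) k := by
  induction k with
  | zero => simp
  | succ k ih =>
    have hv := Nat.add_choose_eq (k * (q + 1)) (q + 1) (k + 1)
    have hterm : Nat.choose (k * (q + 1)) k * Nat.choose (q + 1) 1 ≤
        Nat.choose (k * (q + 1) + (q + 1)) (k + 1) := by
      rw [hv]
      exact Finset.single_le_sum (f := fun ij : ℕ × ℕ => Nat.choose (k * (q + 1)) ij.1 * Nat.choose (q + 1) ij.2)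
        (fun i _ => Nat.zero_le _) (a := (k, 1)) (by simp)
    rw [Nat.choose_one_right] at hterm
    have heq : (k + 1) * (q + 1) = k * (q + 1) + (q + 1) := by ring
    calc (q + 1) ^ (k + 1) = (q + 1) ^ k * (q + 1) := pow_succ _ _
      _ ≤ Nat.choose (k * (q + 1)) k * (q + 1) := Nat.mul_le_mul_right _ ih
      _ ≤ Nat.choose (k * (q + 1) + (q + 1)) (k + 1) := hterm
      _ = Nat.choose ((k + 1) * (q + 1)) (k + 1) := by rw [heq]

/-- `4n ≤ 2^n` for `n ≥ 4`. [folklore] -/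
theorem four_mul_le_two_pow (n : ℕ) (hn : 4 ≤ n) : 4 * n ≤ 2 ^ n := by
  induction n, hn using Nat.le_induction with
  | base => norm_num
  | succ n hn ih =>
    have h4 : 4 ≤ 2 ^ n := by
      calc (4 : ℕ) = 2 ^ 2 := by norm_num
        _ ≤ 2 ^ n := Nat.pow_le_pow_right (by norm_num) (by omega)
    calc 4 * (n + 1) = 4 * n + 4 := by ring
      _ ≤ 2 ^ n + 2 ^ n := Nat.add_le_add ih h4
      _ = 2 ^ (n + 1) := by rw [pow_succ]; ring

/-- **The Descartes mechanism for the fat lifting stub contradicts tropical Conjecture B.**  If the tropical census were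
near-counting-tight on ALL fat formats — `log₂² m ≤ K ∧ TropRootLawAt m K n ⇒ C(m+K−1, m) ≤ 2^(C₁K)·(n+1)` for one `C₁` —
then `TropKPlusLogSqLaw` (= the route crux `TropicalB`) fails: at `K = 4^i`, `m = 2^(2^i)` (`log₂² m = K`), TB gives the row
with `n = 2^(2CK)`, whence `C(m+K−1,m) ≤ 2^((C₁+2C+1)K)`, against `C(m+K−1,m) ≥ (m/K)^(K−1) = 2^((2^i − 2i)(K−1))`. [folklore] -/
theorem not_tropKPlusLogSqLaw_of_descartesFat
    (h : ∃ C₁ : ℕ, ∀ m K n : ℕ, Nat.log 2 m ^ 2 ≤ K → TropRootLawAt m K n →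
      Nat.choose (m + K - 1) m ≤ 2 ^ (C₁ * K) * (n + 1)) :
    ¬ TropKPlusLogSqLaw := by
  rintro ⟨C, hC⟩
  obtain ⟨C₁, h⟩ := h
  -- the witness format
  set A : ℕ := C₁ + 2 * C + 1 with hA
  set i : ℕ := A + 4 with hi
  set K : ℕ := 4 ^ i with hK
  set L : ℕ := 2 ^ i with hL
  set m : ℕ := 2 ^ L with hm
  have hi4 : 4 ≤ i := by omega
  have hlog : Nat.log 2 m = L := by rw [hm, Nat.log_pow (by norm_num)]
  have hKL : K = L ^ 2 := by
    rw [hL, hK, ← pow_mul, show (4 : ℕ) = 2 ^ 2 by norm_num, ← pow_mul, Nat.mul_comm]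
  have hK1 : 1 ≤ K := Nat.one_le_pow _ _ (by norm_num)
  have hK2 : 2 ≤ K := by
    calc (2 : ℕ) ≤ 4 ^ 1 := by norm_num
      _ ≤ 4 ^ i := Nat.pow_le_pow_right (by norm_num) (by omega)
  -- 2i ≤ L, and j := L − 2i ≥ 2i
  have h4i : 4 * i ≤ L := by rw [hL]; exact four_mul_le_two_pow i hi4
  set j : ℕ := L - 2 * i with hj
  have hLj : L = 2 * i + j := by omega
  have hj2 : 2 * A + 8 ≤ j := by omega
  have hmK : m = K * 2 ^ j := by
    rw [hm, hLj, pow_add, hK, pow_mul]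
    norm_num
  -- TB at (m, K) and the mechanism hypothesis
  have hT : TropRootLawAt m K (2 ^ (C * (K + K))) := by
    have := hC m K
    rwa [hlog, ← hKL] at this
  have h1 := h m K (2 ^ (C * (K + K))) (by rw [hlog, ← hKL]) hT
  -- upper bound
  have hup : 2 ^ (C₁ * K) * (2 ^ (C * (K + K)) + 1) ≤ 2 ^ (A * K) := by
    have e1 : 2 ^ (C * (K + K)) + 1 ≤ 2 ^ (C * (K + K) + 1) :=
      Nat.pow_lt_pow_right (by norm_num) (Nat.lt_succ_self _)
    calc 2 ^ (C₁ * K) * (2 ^ (C * (K + K)) + 1) ≤ 2 ^ (C₁ * K) * 2 ^ (C * (K + K) + 1) :=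
          Nat.mul_le_mul_left _ e1
      _ = 2 ^ (C₁ * K + (C * (K + K) + 1)) := (pow_add _ _ _).symm
      _ ≤ 2 ^ (A * K) := Nat.pow_le_pow_right (by norm_num) (by rw [hA]; nlinarith [hK1])
  -- lower bound
  have hKm : m + K - 1 = m + (K - 1) := by omega
  have hsymm : Nat.choose (m + K - 1) m = Nat.choose (m + (K - 1)) (K - 1) := by
    rw [hKm]; exact Nat.choose_symm_of_eq_add rfl
  have harg : (K - 1) * (2 ^ j + 1) ≤ m + (K - 1) := by
    have e1 : (K - 1) * (2 ^ j + 1) = (K - 1) * 2 ^ j + (K - 1) := by ring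
    have e2 : (K - 1) * 2 ^ j ≤ K * 2 ^ j := Nat.mul_le_mul_right _ (Nat.sub_le K 1)
    rw [e1, hmK]
    omega
  have hlow : 2 ^ (j * (K - 1)) ≤ Nat.choose (m + K - 1) m := by
    rw [hsymm, pow_mul]
    calc (2 ^ j) ^ (K - 1) ≤ (2 ^ j + 1) ^ (K - 1) := Nat.pow_le_pow_left (Nat.le_succ _) _
      _ ≤ Nat.choose ((K - 1) * (2 ^ j + 1)) (K - 1) := succ_pow_le_choose_mul (2 ^ j) (K - 1)
      _ ≤ Nat.choose (m + (K - 1)) (K - 1) := Nat.choose_le_choose (K - 1) harg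
  -- combine: j (K − 1) ≤ A K, contradiction with j ≥ 2A + 8, K ≥ 2
  have hfin : j * (K - 1) ≤ A * K :=
    (Nat.pow_le_pow_iff_right (by norm_num)).mp (hlow.trans (h1.trans hup))
  have hK' : K = (K - 1) + 1 := by omega
  have hprod : (2 * A + 8) * (K - 1) ≤ j * (K - 1) := Nat.mul_le_mul_right _ hj2
  have hKm1 : 1 ≤ K - 1 := by omega
  nlinarith [hprod, hfin, hKm1, hK']

/-- The same with the route's `TropRow`-free phrasing of the real side: if the Descartes mechanism proved the fat lifting
STUB SHAPE with the Descartes ceiling as the only real input — i.e. `2·C(m+K−1,m) − 1 ≤ 2^(C₁K)(n+1)` from the tropical row on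
every fat format — then tropical Conjecture B fails. [folklore] -/
theorem not_tropKPlusLogSqLaw_of_descartesFat' 
    (h : ∃ C₁ : ℕ, ∀ m K n : ℕ, Nat.log 2 m ^ 2 ≤ K → TropRootLawAt m K n →
      2 * Nat.choose (m + K - 1) m - 1 ≤ 2 ^ (C₁ * K) * (n + 1)) :
    ¬ TropKPlusLogSqLaw := by
  apply not_tropKPlusLogSqLaw_of_descartesFat
  obtain ⟨C₁, h⟩ := h
  refine ⟨C₁, fun m K n hK hT => ?_⟩
  have := h m K n hK hT
  omega

end Summit.ValiantsHypothesis.ValiantsHypothesis.Theorems.KPlusLogSqLaw
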